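import Summits.Ventures.HodgeRepro2.T5SU11ImproperDerivativeIdentity

/-!
# The energy bracket of the improper Green's solution at both ends, and the integrability of the energy terms

For `λ > 2` and a source `g` of the exponentially decaying class at a rate `ε > 1`, with `u = G^I_λ g` and `u′` bounded
near `0` and `O(e^{−ε′ t})` at infinity for every `ε′ < min(ε, λ)` (row 525):

* **the energy bracket `E(t) = sinh 2t · u(t) u′(t)` tends to `0` at both ends** (`tendsto_energy_bracket_nhdsGT_zero`,
  `tendsto_energy_bracket_atTop`: `|E| ≤ (e^{2t}/2) K₁ K₂ e^{−2ε′ t}` with `ε′ > 1`);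
* the three energy terms are integrable on `(0, ∞)` (`integrableOn_sinh_mul_greenSolI_sq`,
  `integrableOn_sinh_mul_greenSolI'_sq`, `integrableOn_sinh_mul_mul_greenSolI`: row 525's criterion).

These are the ingredients of the energy identity of the resolvent on the class (next row). Nothing is claimed about (N).

Blind lane: Mathlib + the HodgeRepro2 prefix only; no sorry; axioms ⊆ {propext, Classical.choice,
Quot.sound}.
-/

namespace Summit.Ventures.HodgeRepro2.T5SU11ImproperEnergyBracket

open Filter Topology MeasureTheory
open Set (Ioi Ioc Icc Ioo)
open T5SU11Cartan T5SU11SphericalFunction T5SU11SphericalBounds T5SU11SphericalContinuous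
  T5SU11SphericalSolutionSpaceAll T5SU11SphericalAsymptotic T5SU11SphericalCfun T5SU11SphericalDecay
  T5SU11SphericalDecayAsymptotic T5SU11SphericalDecayBracket T5SU11SphericalLpSharp T5SU11SoninPolyaGroup
  T5SU11ReductionOfOrder T5SU11ResolventBoundary T5SU11ResolventDiagonalEdge T5SU11RadialGreenImproper
  T5SU11RadialGreenImproperOrigin T5SU11RadialGreenImproperDecaySource T5SU11RadialGreenImproperStable
  T5SU11ImproperDerivativeIdentity

section measure

variable [MeasurableSpace Circle] [BorelSpace Circle]

variable {lam : ℝ} (hlam : 1 < lam) {g : ℝ → ℝ} (hg : ContinuousOn g (Ioi 0))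
  {M : ℝ} (hM : ∀ s ∈ Ioc (0 : ℝ) 1, |g s| ≤ M) (hM0 : 0 ≤ M)
  {ε C s₀ : ℝ} (hε : 2 - lam < ε) (hC : ∀ s, s₀ ≤ s → |g s| ≤ C * Real.exp (-ε * s))
  (h2 : 2 < lam)

/-! ### The energy bracket at both ends, and the integrability of the energy terms -/

include hlam h2 hg hM hM0 hε hC in
/-- **`E(t) = sinh 2t · u u′ → 0` as `t → 0⁺`**: `u` and `u′` are bounded near the origin. -/
theorem tendsto_energy_bracket_nhdsGT_zero :
    Tendsto (fun t => Real.sinh (2 * t) * (greenSolI (fun t => sph lam (hyp t)) (sphDecay lam) g t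
      * greenSolI' (deriv fun t => sph lam (hyp t)) (sphDecay' lam) (fun t => sph lam (hyp t)) (sphDecay lam) g t))
      (𝓝[>] 0) (𝓝 0) := by
  have hA := integrableOn_sphDecay_mul_mul_sinh hlam hg hM hM0 hε hC
  obtain ⟨B, hB⟩ := eventually_abs_greenSolI_le hlam hM hM0 hA
  obtain ⟨B', hB'⟩ := eventually_abs_greenSolI'_le hlam hg hM hM0 hε hC h2
  have hlim : Tendsto (fun t => Real.sinh (2 * t) * (|B| * |B'|)) (𝓝[>] (0 : ℝ)) (𝓝 0) := by
    have : Tendsto (fun t => Real.sinh (2 * t) * (|B| * |B'|)) (𝓝 (0 : ℝ)) (𝓝 (Real.sinh (2 * 0) * (|B| * |B'|))) :=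
      ((Real.continuous_sinh.comp (continuous_const.mul continuous_id)).mul continuous_const).tendsto 0
    simp only [mul_zero, Real.sinh_zero, zero_mul] at this
    exact this.mono_left nhdsWithin_le_nhds
  refine squeeze_zero_norm' ?_ hlim
  filter_upwards [hB, hB', self_mem_nhdsWithin] with t hBt hB't ht
  have ht0 : 0 < t := ht
  have hsinh : 0 ≤ Real.sinh (2 * t) := Real.sinh_nonneg_iff.mpr (by linarith)
  rw [Real.norm_eq_abs, abs_mul, abs_of_nonneg hsinh, abs_mul]
  apply mul_le_mul_of_nonneg_left _ hsinh
  exact mul_le_mul (le_trans hBt (le_abs_self B)) (le_trans hB't (le_abs_self B')) (abs_nonneg _) (abs_nonneg _)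

include hlam h2 hg hM hM0 hε hC in
/-- **`E(t) = sinh 2t · u u′ → 0` as `t → ∞`** for a source of rate `ε > 1`. -/
theorem tendsto_energy_bracket_atTop (hε1 : 1 < ε) :
    Tendsto (fun t => Real.sinh (2 * t) * (greenSolI (fun t => sph lam (hyp t)) (sphDecay lam) g t
      * greenSolI' (deriv fun t => sph lam (hyp t)) (sphDecay' lam) (fun t => sph lam (hyp t)) (sphDecay lam) g t))
      atTop (𝓝 0) := by
  have hmin : 1 < min ε lam := lt_min hε1 (by linarith)
  set ε' := (1 + min ε lam) / 2 with hε'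
  have hε'1 : 1 < ε' := by rw [hε']; linarith
  have hε'2 : ε' < min ε lam := by rw [hε']; linarith
  obtain ⟨K₁, T₁, hK₁, hT₁, hKT₁⟩ := exists_abs_greenSolI_le_exp hlam hg hM hM0 hε hC hε'2
  obtain ⟨K₂, T₂, hK₂, hT₂, hKT₂⟩ := exists_abs_greenSolI'_le_exp hlam hg hM hM0 hε hC h2 hε'2
  have hlim : Tendsto (fun t => K₁ * K₂ / 2 * Real.exp (-(2 * ε' - 2) * t)) atTop (𝓝 0) := by
    have := (Real.tendsto_exp_neg_atTop_nhds_zero.comp (tendsto_id.const_mul_atTop (by linarith : 0 < 2 * ε' - 2)))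
      |>.const_mul (K₁ * K₂ / 2)
    rw [mul_zero] at this
    exact this.congr (fun t => by simp only [Function.comp_def, id]; ring_nf)
  refine squeeze_zero_norm' ?_ hlim
  filter_upwards [eventually_ge_atTop (max T₁ T₂)] with t ht
  have ht1 : T₁ ≤ t := le_trans (le_max_left _ _) ht
  have ht2 : T₂ ≤ t := le_trans (le_max_right _ _) ht
  have ht0 : 0 < t := lt_of_lt_of_le hT₁ ht1
  have hsinh : 0 ≤ Real.sinh (2 * t) := Real.sinh_nonneg_iff.mpr (by linarith)
  rw [Real.norm_eq_abs, abs_mul, abs_of_nonneg hsinh, abs_mul]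
  calc Real.sinh (2 * t) * (|greenSolI (fun t => sph lam (hyp t)) (sphDecay lam) g t|
        * |greenSolI' (deriv fun t => sph lam (hyp t)) (sphDecay' lam) (fun t => sph lam (hyp t)) (sphDecay lam) g t|)
      ≤ Real.exp (2 * t) / 2 * ((K₁ * Real.exp (-ε' * t)) * (K₂ * Real.exp (-ε' * t))) :=
        mul_le_mul (sinh_le_exp_div_two _) (mul_le_mul (hKT₁ t ht1) (hKT₂ t ht2) (abs_nonneg _) (by positivity))
          (by positivity) (by positivity)
    _ = K₁ * K₂ / 2 * (Real.exp (2 * t) * Real.exp (-ε' * t) * Real.exp (-ε' * t)) := by ring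
    _ = K₁ * K₂ / 2 * Real.exp (-(2 * ε' - 2) * t) := by
        rw [← Real.exp_add, ← Real.exp_add]; congr 2; ring

include hlam h2 hg hM hM0 hε hC in
/-- `sinh 2t · u²` is integrable on `(0, ∞)` for a source of rate `ε > 1`. -/
theorem integrableOn_sinh_mul_greenSolI_sq (hε1 : 1 < ε) :
    IntegrableOn (fun t => Real.sinh (2 * t) * greenSolI (fun t => sph lam (hyp t)) (sphDecay lam) g t ^ 2) (Ioi 0) := by
  have hA := integrableOn_sphDecay_mul_mul_sinh hlam hg hM hM0 hε hC
  obtain ⟨B, hB⟩ := eventually_abs_greenSolI_le hlam hM hM0 hA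
  have hmin : 1 < min ε lam := lt_min hε1 (by linarith)
  set ε' := (1 + min ε lam) / 2 with hε'
  have hε'1 : 1 < ε' := by rw [hε']; linarith
  have hε'2 : ε' < min ε lam := by rw [hε']; linarith
  obtain ⟨K₁, T₁, hK₁, hT₁, hKT₁⟩ := exists_abs_greenSolI_le_exp hlam hg hM hM0 hε hC hε'2
  have hcont : ContinuousOn (fun t => Real.sinh (2 * t) * greenSolI (fun t => sph lam (hyp t)) (sphDecay lam) g t ^ 2)
      (Ioi 0) :=
    (Real.continuous_sinh.comp (continuous_const.mul continuous_id)).continuousOn.mul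
      ((continuousOn_greenSolI hlam hg hM hM0 hε hC).pow 2)
  refine integrableOn_Ioi_of_bounded_of_decay hcont (B := Real.sinh 2 * B ^ 2) ?_ (K := K₁ ^ 2 / 2) (T := T₁)
    (κ := 2 * ε' - 2) (by linarith) ?_
  · filter_upwards [hB, Ioo_mem_nhdsGT one_pos] with t hBt ht
    have hsinh : 0 ≤ Real.sinh (2 * t) := Real.sinh_nonneg_iff.mpr (by linarith [ht.1])
    rw [abs_mul, abs_of_nonneg hsinh, abs_pow]
    apply mul_le_mul (Real.sinh_le_sinh.mpr (by linarith [ht.2])) (pow_le_pow_left₀ (abs_nonneg _) hBt 2)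
      (by positivity) (Real.sinh_pos_iff.mpr two_pos).le
  · intro t ht
    have ht0 : 0 < t := lt_of_lt_of_le hT₁ ht
    have hsinh : 0 ≤ Real.sinh (2 * t) := Real.sinh_nonneg_iff.mpr (by linarith)
    rw [abs_mul, abs_of_nonneg hsinh, abs_pow]
    calc Real.sinh (2 * t) * |greenSolI (fun t => sph lam (hyp t)) (sphDecay lam) g t| ^ 2
        ≤ Real.exp (2 * t) / 2 * (K₁ * Real.exp (-ε' * t)) ^ 2 :=
          mul_le_mul (sinh_le_exp_div_two _) (pow_le_pow_left₀ (abs_nonneg _) (hKT₁ t ht) 2) (by positivity)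
            (by positivity)
      _ = K₁ ^ 2 / 2 * (Real.exp (2 * t) * (Real.exp (-ε' * t) * Real.exp (-ε' * t))) := by ring
      _ = K₁ ^ 2 / 2 * Real.exp (-(2 * ε' - 2) * t) := by
          rw [← Real.exp_add, ← Real.exp_add]; congr 2; ring

include hlam h2 hg hM hM0 hε hC in
/-- `sinh 2t · u′²` is integrable on `(0, ∞)` for a source of rate `ε > 1`, `λ > 2`. -/
theorem integrableOn_sinh_mul_greenSolI'_sq (hε1 : 1 < ε) :
    IntegrableOn (fun t => Real.sinh (2 * t) * greenSolI' (deriv fun t => sph lam (hyp t)) (sphDecay' lam)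
      (fun t => sph lam (hyp t)) (sphDecay lam) g t ^ 2) (Ioi 0) := by
  obtain ⟨B', hB'⟩ := eventually_abs_greenSolI'_le hlam hg hM hM0 hε hC h2
  have hmin : 1 < min ε lam := lt_min hε1 (by linarith)
  set ε' := (1 + min ε lam) / 2 with hε'
  have hε'1 : 1 < ε' := by rw [hε']; linarith
  have hε'2 : ε' < min ε lam := by rw [hε']; linarith
  obtain ⟨K₂, T₂, hK₂, hT₂, hKT₂⟩ := exists_abs_greenSolI'_le_exp hlam hg hM hM0 hε hC h2 hε'2
  have hB := integrableOn_sph_mul_mul_sinh_Ioc hg hM hM0 lam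
  have hA := integrableOn_sphDecay_mul_mul_sinh hlam hg hM hM0 hε hC
  have hcont' : ContinuousOn (greenSolI' (deriv fun t => sph lam (hyp t)) (sphDecay' lam) (fun t => sph lam (hyp t))
      (sphDecay lam) g) (Ioi 0) :=
    fun t ht => (hasDerivAt_greenSolI' (hφ_sph lam) (hφ'_sph lam) (fun _ hs => hasDerivAt_sphDecay hlam hs)
      (fun _ hs => hasDerivAt_sphDecay' lam hs) hg hB hA ht).continuousAt.continuousWithinAt
  have hcont : ContinuousOn (fun t => Real.sinh (2 * t) * greenSolI' (deriv fun t => sph lam (hyp t)) (sphDecay' lam)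
      (fun t => sph lam (hyp t)) (sphDecay lam) g t ^ 2) (Ioi 0) :=
    (Real.continuous_sinh.comp (continuous_const.mul continuous_id)).continuousOn.mul (hcont'.pow 2)
  refine integrableOn_Ioi_of_bounded_of_decay hcont (B := Real.sinh 2 * B' ^ 2) ?_ (K := K₂ ^ 2 / 2) (T := T₂)
    (κ := 2 * ε' - 2) (by linarith) ?_
  · filter_upwards [hB', Ioo_mem_nhdsGT one_pos] with t hBt ht
    have hsinh : 0 ≤ Real.sinh (2 * t) := Real.sinh_nonneg_iff.mpr (by linarith [ht.1])
    rw [abs_mul, abs_of_nonneg hsinh, abs_pow]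
    apply mul_le_mul (Real.sinh_le_sinh.mpr (by linarith [ht.2])) (pow_le_pow_left₀ (abs_nonneg _) hBt 2)
      (by positivity) (Real.sinh_pos_iff.mpr two_pos).le
  · intro t ht
    have ht0 : 0 < t := lt_of_lt_of_le hT₂ ht
    have hsinh : 0 ≤ Real.sinh (2 * t) := Real.sinh_nonneg_iff.mpr (by linarith)
    rw [abs_mul, abs_of_nonneg hsinh, abs_pow]
    calc Real.sinh (2 * t) * |greenSolI' (deriv fun t => sph lam (hyp t)) (sphDecay' lam) (fun t => sph lam (hyp t))
          (sphDecay lam) g t| ^ 2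
        ≤ Real.exp (2 * t) / 2 * (K₂ * Real.exp (-ε' * t)) ^ 2 :=
          mul_le_mul (sinh_le_exp_div_two _) (pow_le_pow_left₀ (abs_nonneg _) (hKT₂ t ht) 2) (by positivity)
            (by positivity)
      _ = K₂ ^ 2 / 2 * (Real.exp (2 * t) * (Real.exp (-ε' * t) * Real.exp (-ε' * t))) := by ring
      _ = K₂ ^ 2 / 2 * Real.exp (-(2 * ε' - 2) * t) := by
          rw [← Real.exp_add, ← Real.exp_add]; congr 2; ring

include hlam hg hM hM0 hε hC in
/-- `sinh 2t · g u` is integrable on `(0, ∞)` for a source of rate `ε > 1`. -/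
theorem integrableOn_sinh_mul_mul_greenSolI (hε1 : 1 < ε) :
    IntegrableOn (fun t => Real.sinh (2 * t) * (g t * greenSolI (fun t => sph lam (hyp t)) (sphDecay lam) g t))
      (Ioi 0) := by
  have hA := integrableOn_sphDecay_mul_mul_sinh hlam hg hM hM0 hε hC
  obtain ⟨B, hB⟩ := eventually_abs_greenSolI_le hlam hM hM0 hA
  have hmin : 1 < min ε lam := lt_min hε1 hlam
  set ε' := (1 + min ε lam) / 2 with hε'
  have hε'1 : 1 < ε' := by rw [hε']; linarith
  have hε'2 : ε' < min ε lam := by rw [hε']; linarith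
  obtain ⟨K₁, T₁, hK₁, hT₁, hKT₁⟩ := exists_abs_greenSolI_le_exp hlam hg hM hM0 hε hC hε'2
  have hC0 : 0 ≤ C := by
    have hb0 := hC (max s₀ 0) (le_max_left _ _)
    have := abs_nonneg (g (max s₀ 0))
    have := Real.exp_pos (-ε * max s₀ 0)
    nlinarith
  have hcont : ContinuousOn (fun t => Real.sinh (2 * t) * (g t * greenSolI (fun t => sph lam (hyp t)) (sphDecay lam) g t))
      (Ioi 0) :=
    (Real.continuous_sinh.comp (continuous_const.mul continuous_id)).continuousOn.mul
      (hg.mul (continuousOn_greenSolI hlam hg hM hM0 hε hC))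
  refine integrableOn_Ioi_of_bounded_of_decay hcont (B := Real.sinh 2 * (M * B)) ?_ (K := C * K₁ / 2)
    (T := max T₁ s₀) (κ := ε + ε' - 2) (by linarith) ?_
  · filter_upwards [hB, Ioo_mem_nhdsGT one_pos] with t hBt ht
    have hsinh : 0 ≤ Real.sinh (2 * t) := Real.sinh_nonneg_iff.mpr (by linarith [ht.1])
    rw [abs_mul, abs_of_nonneg hsinh, abs_mul]
    apply mul_le_mul (Real.sinh_le_sinh.mpr (by linarith [ht.2]))
      (mul_le_mul (hM t ⟨ht.1, ht.2.le⟩) hBt (abs_nonneg _) hM0) (by positivity) (Real.sinh_pos_iff.mpr two_pos).le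
  · intro t ht
    have ht1 : T₁ ≤ t := le_trans (le_max_left _ _) ht
    have hts : s₀ ≤ t := le_trans (le_max_right _ _) ht
    have ht0 : 0 < t := lt_of_lt_of_le hT₁ ht1
    have hsinh : 0 ≤ Real.sinh (2 * t) := Real.sinh_nonneg_iff.mpr (by linarith)
    rw [abs_mul, abs_of_nonneg hsinh, abs_mul]
    calc Real.sinh (2 * t) * (|g t| * |greenSolI (fun t => sph lam (hyp t)) (sphDecay lam) g t|)
        ≤ Real.exp (2 * t) / 2 * ((C * Real.exp (-ε * t)) * (K₁ * Real.exp (-ε' * t))) :=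
          mul_le_mul (sinh_le_exp_div_two _) (mul_le_mul (hC t hts) (hKT₁ t ht1) (abs_nonneg _) (by positivity))
            (by positivity) (by positivity)
      _ = C * K₁ / 2 * (Real.exp (2 * t) * (Real.exp (-ε * t) * Real.exp (-ε' * t))) := by ring
      _ = C * K₁ / 2 * Real.exp (-(ε + ε' - 2) * t) := by
          rw [← Real.exp_add, ← Real.exp_add]; congr 2; ring

end measure

end Summit.Ventures.HodgeRepro2.T5SU11ImproperEnergyBracket
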